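import Mathlib
import Summits.Ventures.FusionMHD.Models.CerfonFreidbergIterLikeQHalfStrip
import Summits.Ventures.FusionMHD.Models.CerfonFreidbergIterLikeQHalfShearEnvelope
import Summits.Ventures.FusionMHD.Models.CerfonFreidbergIterLikeQHalfShearSound
import Summits.Ventures.FusionMHD.Models.FluxSurfacePolarRayLevelKernels
import HarnessLib

/-!
# Ventures/FusionMHD — Models/CerfonFreidbergIterLikeQHalfShearLink.lean: the PER-PANEL LINK of the SHEAR REGISTER from ★ #117's
# certified approximant to the TRUE surface `ψ_N = 1/2` of THE Cerfon–Freidberg ITER-like flux — Lipschitz tube envelope of the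
# `q′`-kernel, the eight third-derivative range boxes of record, and `shear_panel_bracket`

HONEST FRAMING (LADDER-GRIDFUSION three columns; CF rung, F2 item R2; «F2.R2-CF-SHEAR-ITER» = step (4) of `pub/gridfusion/models/F2-SCOPING.md`
v1.6 §10(c) on model-5 g8's shear chain `…QHalfShearDefs/ShearPanels1–16/ShearSound`).
* CERTIFIED (kernel; this file + imports, axioms standard): for the `q′`-kernel of Jardin's (8.134) shear input,
  `K(θ, s) = polarKernelDs X_a D F2 θ s / D θ s = X_a/(R²D²) − s·F2/(R·D³)` (`R = X_a + s cos θ`, `D = D_r`, `F2 = ∂_s D_r`; model-7's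
  `hasDerivAt_safetyFactorE_half`), on each of ★ #117's 32 panels `Θ_j` of `[0, π]`:
  (the TUBE ENVELOPE `|K(θ, s) − K(θ, m)| ≤ E` for `|s − m| ≤ r` is the pure algebra of `…QHalfShearEnvelope.shear_envelope`);
  (§1) EIGHT natural-extension RANGE BOXES (`decide`, seconds) of the constant-folded third-ray-derivative code list `d3S`
  (`…QHalfStrip`) over the instance box × four panels × the union of their tubes: `|∂_s F2| ≤ 11` there;
  (§2–§3) per panel, from the records `d, b, ℓ` of ★ #117 (their `ok`/`check` already decided in the tree), model-5 g8's shear certificate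
  `sc : ShearCert` (`sc.ok`: Taylor-model integral of `K·π` ALONG THE APPROXIMANT inside `[plo, phi]/2⁶⁰`) and NEW rational link constants
  `sl : ShearLink` passing `sl.check` (tube radius `r_j ≤ 8·10⁻⁹` ⇒ `E_j ≤ 9·10⁻⁵`): **`shear_panel_bracket`** —
  `Lo_j ≤ ∫_{Θ_j} K(θ, ρ(θ)) dθ ≤ Hi_j` for the TRUE glued ray radius `ρ` of the surface (model-7's `LevelPanel.kernel_integral_tube` on
  `CFIterLike.QHalf.levelPanel_of_check`, the strip facts `stripFacts_of_check`, the envelope lemma), with integrability.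
* VALIDATED (never used): float `(dq/du)/F = 31.7311512` (model-5 g8); the 32 brackets sum to `[99.68623, 99.68647] ∋ π·31.73115`.
* MODELLED: analytic Cerfon–Freidberg family (ideal MHD, Solov'ev profiles, α = 0); the shear of a MODEL flux surface — nothing about a
  device or stability.  One `decide +kernel` (§1, eight boxes).  Typer/prover: gridfusion-model-7 (g7), 2026-08-27.
Citations: Freidberg 2014 §6.3.5 (6.35) [Freidberg2014]; Jardin 2010 §8.5 (8.134) [Jardin2010]; Moore 1979 §4.3 (4.21) [Moore1979].
-/

noncomputable section

open Set MeasureTheory intervalIntegral Filter Topology NonemptyInterval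
open Literature.Analysis.ODE Literature.Analysis.ODE.FExpr
open Literature.Analysis.ValidatedNumerics Literature.Analysis.ValidatedNumerics.PolyMP
open Literature.Analysis.ValidatedNumerics.NumericsMP Literature.Analysis.ValidatedNumerics.ExpPoly
open Literature.Analysis.ValidatedNumerics.ITaylor
open Literature.MathematicalPhysics.MHD Literature.MathematicalPhysics.MHD.CerfonFreidberg
open Summit.Ventures.FusionMHD.Models.PolarRay
open Summit.Ventures.FusionMHD.Models.CFIterLike.PolarPanel

set_option autoImplicit false

namespace Summit.Ventures.FusionMHD.Models.CFIterLike.QHalf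

/-! ## §1 The shear kernel and the eight third-derivative boxes of record -/

/-- **The `q′`-kernel** `K(θ, s) = polarKernelDs X_a Dfield F2field θ s / Dfield θ s` (the integrand of `hasDerivAt_safetyFactorE_half`). -/
def shearK (θ s : ℝ) : ℝ := polarKernelDs Xa Dfield F2field θ s / Dfield θ s

/-- Algebraic form of the kernel where `R ≠ 0`, `D ≠ 0`: `K = X_a/(R²D²) − s·F2/(R·D³)`. -/
theorem shearK_eq {θ s : ℝ} (hR : Xa + s * Real.cos θ ≠ 0) (hD : Dfield θ s ≠ 0) :
    shearK θ s = Xa / ((Xa + s * Real.cos θ) ^ 2 * Dfield θ s ^ 2) - s * F2field θ s / ((Xa + s * Real.cos θ) * Dfield θ s ^ 3) := by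
  unfold shearK polarKernelDs
  field_simp

/-- Natural-extension configuration for the third-derivative boxes (40-bit rounding, 12 Taylor terms, 3 halvings). -/
def cfgF3 : SeedCfg := ⟨40, 30, 12, 3, 0⟩

/-- The bound of record `M₃ = 11` on `|∂_s F2|` over every box. -/
def M3Q : ℚ := 11

/-- Upper rational bound of `X_a` (`CFIterLike.Xa_bounds`). -/
def XaHiQ : ℚ := 104543965 / 100000000

/-- **The eight `(θ, s)`-boxes of record** `(θ⁻, θ⁺, s⁻, s⁺)`: four panels each (`θ ∈ [πg/8, π(g+1)/8]` outward-rounded to `10⁻⁶`) times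
the union of their tubes `[m⁻ − r, m⁺ + r]` (outward-rounded). [instance data] -/
def f3Box : ℕ → ℚ × ℚ × ℚ × ℚ
  | 0 => (0, (3927 / 10000), (49899 / 250000), (103883 / 500000))
  | 1 => ((392699 / 1000000), (785399 / 1000000), (3242 / 15625), (233257 / 1000000))
  | 2 => ((392699 / 500000), (589049 / 500000), (116451 / 500000), (140287 / 500000))
  | 3 => ((1178097 / 1000000), (1570797 / 1000000), (70059 / 250000), (173057 / 500000))
  | 4 => ((392699 / 250000), (245437 / 125000), (345569 / 1000000), (372273 / 1000000))
  | 5 => ((392699 / 200000), (471239 / 200000), (151331 / 500000), (36599 / 100000))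
  | 6 => ((1178097 / 500000), (1374447 / 500000), (64123 / 250000), (18941 / 62500))
  | 7 => ((2748893 / 1000000), (3141593 / 1000000), (121167 / 500000), (257007 / 1000000))
  | _ => (0, 0, 0, 0)

/-- The box obligation: the box is well formed and the natural extension of `d3S` over it lies in `[−M₃, M₃]`. -/
def f3ok (g : ℕ) : Bool :=
  let B := f3Box g
  if h : B.1 ≤ B.2.1 ∧ B.2.2.1 ≤ B.2.2.2 then
    evalBoxLE cfgF3 d3S (regionBox B.1 B.2.1 B.2.2.1 B.2.2.2 h.1 h.2) ⟨(-M3Q, M3Q), by norm_num [M3Q]⟩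
  else false

/-- **KERNEL CHECK of the eight third-derivative boxes** (natural interval extension of the 3 584-node folded code list; seconds). -/
theorem f3ok_all : ∀ g < 8, f3ok g = true := by decide +kernel

/-- **`|F3field| ≤ M₃` on box `g`.** -/
theorem F3_abs_of_f3ok {g : ℕ} (h : f3ok g = true) {θ s : ℝ}
    (hθ : (((f3Box g).1 : ℚ) : ℝ) ≤ θ ∧ θ ≤ (((f3Box g).2.1 : ℚ) : ℝ))
    (hs : (((f3Box g).2.2.1 : ℚ) : ℝ) ≤ s ∧ s ≤ (((f3Box g).2.2.2 : ℚ) : ℝ)) : |F3field θ s| ≤ ((M3Q : ℚ) : ℝ) := by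
  unfold f3ok at h
  simp only at h
  split_ifs at h with hB
  exact F3_abs_le_of_evalBoxLE h hθ hs

/-! ## §2 Per-panel shear-link data and its rational side conditions -/

/-- Per-panel shear-link constants: panel `j`, third-derivative box `g`, tube envelope `E`, final bracket `[Lo, Hi]` of `∫_{Θ_j} K(θ, ρ θ) dθ`. -/
structure ShearLink where
  /-- panel index -/
  j : ℕ
  /-- index of the third-derivative box containing the panel's tube -/
  g : ℕ
  /-- tube envelope constant `E ≥ envE …` -/
  E : ℚ
  /-- claimed lower bound of the panel integral -/
  Lo : ℚ
  /-- claimed upper bound of the panel integral -/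
  Hi : ℚ

/-- THE RATIONAL SIDE CONDITIONS of the shear link on panel `j` (decided per panel in the assembly file). -/
def ShearLink.check (sl : ShearLink) (ℓ : LinkData) (d : PanelCert) (b : BoxData) (sc : QHalfShear.ShearCert) : Bool :=
  let B := f3Box sl.g
  let μ : ℚ := (d.dlo : ℚ) / tmS - b.M * ℓ.r
  let ν : ℚ := (d.dhi : ℚ) / tmS + b.M * ℓ.r
  let Xlo : ℚ := XaLoQ - b.smax
  let Xhi : ℚ := XaHiQ + b.smax
  decide (sc.j = d.j) && decide (sl.j = d.j) && decide (sl.g < 8)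
  && decide (B.1 ≤ piLoQ * panelLeft hw d.j) && decide (piHiQ * panelLeft hw (d.j + 1) ≤ B.2.1)
  && decide (0 ≤ B.2.2.1) && decide (B.2.2.2 < 1)
  && decide (B.2.2.1 ≤ (d.mlo : ℚ) / tmS - ℓ.r) && decide ((d.mhi : ℚ) / tmS + ℓ.r ≤ B.2.2.2)
  && decide (0 < μ) && decide (0 < Xlo) && decide (0 ≤ sl.E)
  && decide (envE XaHiQ ℓ.r b.M M3Q μ ν Xlo Xhi b.smax ≤ sl.E)
  && decide (sl.Lo ≤ (sc.plo : ℚ) / tmS - sl.E * (piHiQ / 32)) && decide ((sc.phi : ℚ) / tmS + sl.E * (piHiQ / 32) ≤ sl.Hi)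

/-! ## §3 The per-panel shear link theorem -/

section panel

variable {d : PanelCert} {b : BoxData} {ℓ : LinkData} {sc : QHalfShear.ShearCert} {sl : ShearLink}

set_option maxHeartbeats 4000000 in
/-- **THE PER-PANEL SHEAR LINK.**  If panel `j`'s records pass `d.ok`, `b.ok`, `ℓ.check d b`, `levelCheck ℓ d b` (★ #117 / model-7, in the tree),
model-5's shear certificate passes `sc.ok`, and the link constants pass `sl.check`, then
`Lo ≤ ∫_{Θ_j} polarKernelDs X_a Dfield F2field θ (ρ θ)/Dfield θ (ρ θ) dθ ≤ Hi` for the TRUE ray radius `ρ` of the surface `ψ_N = 1/2`,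
with integrability. -/
theorem shear_panel_bracket (hd : d.ok = true) (hb : b.ok = true) (hℓ : ℓ.check d b = true) (hlev : levelCheck ℓ d b = true)
    (hsc : sc.ok = true) (hsl : sl.check ℓ d b sc = true) :
    ((sl.Lo : ℚ) : ℝ) ≤ ∫ θ in (Real.pi * ((panelLeft hw d.j : ℚ) : ℝ))..(Real.pi * ((panelLeft hw (d.j + 1) : ℚ) : ℝ)), shearK θ (ρ θ)
    ∧ ∫ θ in (Real.pi * ((panelLeft hw d.j : ℚ) : ℝ))..(Real.pi * ((panelLeft hw (d.j + 1) : ℚ) : ℝ)), shearK θ (ρ θ) ≤ ((sl.Hi : ℚ) : ℝ)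
    ∧ IntervalIntegrable (fun θ => shearK θ (ρ θ)) volume
        (Real.pi * ((panelLeft hw d.j : ℚ) : ℝ)) (Real.pi * ((panelLeft hw (d.j + 1) : ℚ) : ℝ)) := by
  set a : ℝ := Real.pi * ((panelLeft hw d.j : ℚ) : ℝ) with ha_def
  set a' : ℝ := Real.pi * ((panelLeft hw (d.j + 1) : ℚ) : ℝ) with ha'_def
  have P := levelPanel_of_check hd hb hℓ hlev
  have SF := stripFacts_of_check hd hb hℓ
  -- unpack the rational side conditions
  simp only [ShearLink.check, Bool.and_eq_true, decide_eq_true_eq] at hsl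
  obtain ⟨⟨⟨⟨⟨⟨⟨⟨⟨⟨⟨⟨⟨⟨csj, -⟩, cg⟩, ctlo⟩, cthi⟩, cslo0⟩, cshi1⟩, cslo⟩, cshi⟩, cμ⟩, cXlo⟩, cE0⟩, cE⟩, cLo⟩, cHi⟩ := hsl
  have hbox := f3ok_all sl.g cg
  -- constants
  have hS : (0 : ℝ) < ((tmS : ℕ) : ℝ) := by exact_mod_cast tmS_pos
  have hpi := Real.pi_pos
  have hpiLo : ((piLoQ : ℚ) : ℝ) < Real.pi := by have := Real.pi_gt_d20; norm_num [piLoQ] at this ⊢; exact this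
  have hpiHi : Real.pi < ((piHiQ : ℚ) : ℝ) := by have := Real.pi_lt_d20; norm_num [piHiQ] at this ⊢; exact this
  have hXaLo : ((XaLoQ : ℚ) : ℝ) ≤ Xa := by have := Xa_bounds.1; norm_num [XaLoQ] at this ⊢; exact this
  have hXaHi : Xa ≤ ((XaHiQ : ℚ) : ℝ) := by have := Xa_bounds.2; norm_num [XaHiQ] at this ⊢; exact this
  have hXa0 : 0 < Xa := by linarith [Xa_bounds.1]
  have haa' : a ≤ a' := P.hab
  have hwidth : a' - a = Real.pi / 32 := by
    rw [ha_def, ha'_def]; simp only [panelLeft, hw]; push_cast; ring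
  -- θ ∈ [a, a'] lies in the box's θ-range
  have hpl0 : (0 : ℚ) ≤ panelLeft hw d.j := by unfold panelLeft hw; positivity
  have hθB : ∀ θ ∈ Icc a a', (((f3Box sl.g).1 : ℚ) : ℝ) ≤ θ ∧ θ ≤ (((f3Box sl.g).2.1 : ℚ) : ℝ) := by
    intro θ hθ
    have h1 : (((f3Box sl.g).1 : ℚ) : ℝ) ≤ a := by
      have : (((f3Box sl.g).1 : ℚ) : ℝ) ≤ ((piLoQ : ℚ) : ℝ) * ((panelLeft hw d.j : ℚ) : ℝ) := by exact_mod_cast ctlo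
      have h2 : ((piLoQ : ℚ) : ℝ) * ((panelLeft hw d.j : ℚ) : ℝ) ≤ a := mul_le_mul_of_nonneg_right hpiLo.le (by exact_mod_cast hpl0)
      linarith
    have h2 : a' ≤ (((f3Box sl.g).2.1 : ℚ) : ℝ) := by
      have : ((piHiQ : ℚ) : ℝ) * ((panelLeft hw (d.j + 1) : ℚ) : ℝ) ≤ (((f3Box sl.g).2.1 : ℚ) : ℝ) := by exact_mod_cast cthi
      have hpl1 : (0 : ℝ) ≤ ((panelLeft hw (d.j + 1) : ℚ) : ℝ) := by
        exact_mod_cast (show (0 : ℚ) ≤ panelLeft hw (d.j + 1) by unfold panelLeft hw; positivity)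
      have h3 : a' ≤ ((piHiQ : ℚ) : ℝ) * ((panelLeft hw (d.j + 1) : ℚ) : ℝ) := mul_le_mul_of_nonneg_right hpiHi.le hpl1
      linarith
    exact ⟨h1.trans hθ.1, hθ.2.trans h2⟩
  -- the tube lies in the box's s-range
  have cslo' : (((f3Box sl.g).2.2.1 : ℚ) : ℝ) ≤ (d.mlo : ℝ) / ((tmS : ℕ) : ℝ) - ((ℓ.r : ℚ) : ℝ) := by
    have := (show (((f3Box sl.g).2.2.1 : ℚ) : ℝ) ≤ ((((d.mlo : ℚ) / tmS - ℓ.r : ℚ)) : ℝ) by exact_mod_cast cslo); push_cast at this; exact this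
  have cshi' : (d.mhi : ℝ) / ((tmS : ℕ) : ℝ) + ((ℓ.r : ℚ) : ℝ) ≤ (((f3Box sl.g).2.2.2 : ℚ) : ℝ) := by
    have := (show ((((d.mhi : ℚ) / tmS + ℓ.r : ℚ)) : ℝ) ≤ (((f3Box sl.g).2.2.2 : ℚ) : ℝ) by exact_mod_cast cshi); push_cast at this; exact this
  have hslo0 : (0 : ℝ) ≤ (((f3Box sl.g).2.2.1 : ℚ) : ℝ) := by exact_mod_cast cslo0
  have hshi1 : (((f3Box sl.g).2.2.2 : ℚ) : ℝ) < 1 := by exact_mod_cast cshi1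
  have htubeB : ∀ θ ∈ Icc a a', ∀ s ∈ Icc (mθ θ - ((ℓ.r : ℚ) : ℝ)) (mθ θ + ((ℓ.r : ℚ) : ℝ)),
      s ∈ Icc (((f3Box sl.g).2.2.1 : ℚ) : ℝ) (((f3Box sl.g).2.2.2 : ℚ) : ℝ) := by
    intro θ hθ s hs
    obtain ⟨h1, h2⟩ := SF.m_mem θ hθ
    exact ⟨by linarith [hs.1], by linarith [hs.2]⟩
  -- Lipschitz of F2 on the tube
  have hF2lip : ∀ θ ∈ Icc a a', ∀ s ∈ Icc (mθ θ - ((ℓ.r : ℚ) : ℝ)) (mθ θ + ((ℓ.r : ℚ) : ℝ)),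
      |F2field θ s - F2field θ (mθ θ)| ≤ ((M3Q : ℚ) : ℝ) * ((ℓ.r : ℚ) : ℝ) := by
    intro θ hθ s hs
    have hm : mθ θ ∈ Icc (mθ θ - ((ℓ.r : ℚ) : ℝ)) (mθ θ + ((ℓ.r : ℚ) : ℝ)) := ⟨by linarith [SF.hr], by linarith [SF.hr]⟩
    have h := F2_lipschitz_of_F3 (θ := θ) hslo0 hshi1 (fun x hx => F3_abs_of_f3ok hbox (hθB θ hθ) hx) (htubeB θ hθ s hs) (htubeB θ hθ _ hm)
    have hsm : |s - mθ θ| ≤ ((ℓ.r : ℚ) : ℝ) := abs_le.2 ⟨by linarith [hs.1], by linarith [hs.2]⟩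
    exact h.trans (mul_le_mul_of_nonneg_left hsm (by norm_num [M3Q]))
  -- real versions of μ, ν, Xlo, Xhi and the envelope constant
  set μ : ℝ := (d.dlo : ℝ) / ((tmS : ℕ) : ℝ) - ((b.M : ℚ) : ℝ) * ((ℓ.r : ℚ) : ℝ) with hμ_def
  set ν : ℝ := (d.dhi : ℝ) / ((tmS : ℕ) : ℝ) + ((b.M : ℚ) : ℝ) * ((ℓ.r : ℚ) : ℝ) with hν_def
  set Xlo : ℝ := ((XaLoQ : ℚ) : ℝ) - ((b.smax : ℚ) : ℝ) with hXlo_def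
  set Xhi : ℝ := ((XaHiQ : ℚ) : ℝ) + ((b.smax : ℚ) : ℝ) with hXhi_def
  have hμ0 : 0 < μ := by
    have := (show ((0 : ℚ) : ℝ) < ((((d.dlo : ℚ) / tmS - b.M * ℓ.r : ℚ)) : ℝ) by exact_mod_cast cμ); push_cast at this; exact this
  have hXlo0 : 0 < Xlo := by
    have := (show ((0 : ℚ) : ℝ) < ((XaLoQ - b.smax : ℚ) : ℝ) by exact_mod_cast cXlo); push_cast at this; exact this
  have hE0 : (0 : ℝ) ≤ ((sl.E : ℚ) : ℝ) := by exact_mod_cast cE0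
  have hEenv : envE ((XaHiQ : ℚ) : ℝ) ((ℓ.r : ℚ) : ℝ) ((b.M : ℚ) : ℝ) ((M3Q : ℚ) : ℝ) μ ν Xlo Xhi ((b.smax : ℚ) : ℝ) ≤ ((sl.E : ℚ) : ℝ) := by
    have h := (show ((envE XaHiQ ℓ.r b.M M3Q ((d.dlo : ℚ) / tmS - b.M * ℓ.r) ((d.dhi : ℚ) / tmS + b.M * ℓ.r) (XaLoQ - b.smax) (XaHiQ + b.smax) b.smax : ℚ) : ℝ)
      ≤ ((sl.E : ℚ) : ℝ) by exact_mod_cast cE)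
    rw [envE_cast] at h
    push_cast at h
    exact h
  -- the envelope on the tube
  have hEtube : ∀ θ ∈ Icc a a', ∀ s ∈ Icc (mθ θ - ((ℓ.r : ℚ) : ℝ)) (mθ θ + ((ℓ.r : ℚ) : ℝ)),
      |shearK θ s - shearK θ (mθ θ)| ≤ ((sl.E : ℚ) : ℝ) := by
    intro θ hθ s hs
    have hsS := SF.tube_sub hθ hs
    have hmS := SF.m_sub hθ
    obtain ⟨hDd, hDlo, hDhi⟩ := SF.tube_D hθ hs
    obtain ⟨hDm1, hDm2⟩ := SF.D_m θ hθ
    have hMr : 0 ≤ ((b.M : ℚ) : ℝ) * ((ℓ.r : ℚ) : ℝ) := mul_nonneg SF.hM SF.hr.le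
    have hRs := SF.strip_R (θ := θ) hsS
    have hRm := SF.strip_R (θ := θ) hmS
    have hXs := SF.strip_X_pos (θ := θ) hsS
    have hXm := SF.strip_X_pos (θ := θ) hmS
    have hDs0 : 0 < Dfield θ s := hμ0.trans_le hDlo
    have hDm0 : 0 < Dfield θ (mθ θ) := hμ0.trans_le (by linarith)
    rw [shearK_eq hXs.ne' hDs0.ne', shearK_eq hXm.ne' hDm0.ne']
    have hsm : |s - mθ θ| ≤ ((ℓ.r : ℚ) : ℝ) := abs_le.2 ⟨by linarith [hs.1], by linarith [hs.2]⟩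
    refine (shear_envelope hXa0 hXaHi hμ0 hXlo0 SF.hr.le SF.hM (by norm_num [M3Q]) hsm
      ((StripFacts.R_sub_abs θ s (mθ θ)).trans hsm) hDd (hF2lip θ hθ s hs) ⟨hDlo, hDhi⟩ ⟨by linarith, by linarith⟩
      ⟨by linarith [hRs.1], by linarith [hRs.2]⟩ ⟨by linarith [hRm.1], by linarith [hRm.2]⟩
      ⟨SF.hsA.le.trans hsS.1, hsS.2⟩ ⟨SF.hsA.le.trans hmS.1, hmS.2⟩ (SF.F2_abs θ hθ s hsS) (SF.F2_abs θ hθ _ hmS)).trans hEenv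
  -- continuity of the kernel on the box
  set Bx := Icc a a' ×ˢ Icc ((b.sA : ℚ) : ℝ) ((b.smax : ℚ) : ℝ) with hBx
  have hD0 : ∀ p ∈ Bx, Dfield p.1 p.2 ≠ 0 := fun p hp => (P.slopePos p.1 hp.1 p.2 hp.2).ne'
  have hR0 : ∀ p ∈ Bx, Xa + p.2 * Real.cos p.1 ≠ 0 := fun p hp => (SF.strip_X_pos (θ := p.1) hp.2).ne'
  have hF2c : ContinuousOn (fun p : ℝ × ℝ => F2field p.1 p.2) Bx := continuousOn_F2field_box SF.hsA.le SF.hsmax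
  have hKc : ContinuousOn (fun p : ℝ × ℝ => shearK p.1 p.2) Bx :=
    (continuousOn_polarKernelDs P.slopeCont hF2c hD0 hR0).div P.slopeCont hD0
  -- the approximant's integrand and its certified integral (model-5's shear segment)
  have hsc' := QHalfShear.sound_of_ok hsc
  rw [csj] at hsc'
  obtain ⟨hseg1, hseg2, hsegI⟩ := hsc'
  have hev1 : ∀ t : ℝ, Poly.eval [1] t = 1 := by intro t; simp [Poly.eval_cons, Poly.eval_nil]
  simp only [hev1, mul_one] at hseg1 hseg2 hsegI
  set Φm : ℝ → ℝ := fun θ => shearK θ (mθ θ) with hΦm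
  have hgA : ∀ t : ℝ, QHalfShear.progQ.toFunP params t = Φm (Real.pi * t) * Real.pi := by
    intro t
    rw [QHalfShear.progQ_toFunP]
    simp only [hΦm, shearK, polarKernelDs, mθ, Dfield, F2field, mul_div_cancel_left₀ t hpi.ne']
    rw [div_div, div_eq_mul_inv]
    ring
  have hJ : ∫ t in ((panelLeft hw d.j : ℚ) : ℝ)..((panelLeft hw (d.j + 1) : ℚ) : ℝ), QHalfShear.progQ.toFunP params t
      = ∫ θ in a..a', Φm θ := by
    simp_rw [hgA]
    rw [intervalIntegral.integral_mul_const, mul_comm, ← smul_eq_mul, intervalIntegral.smul_integral_comp_mul_left]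
  have hJlo : (sc.plo : ℝ) / ((tmS : ℕ) : ℝ) ≤ ∫ θ in a..a', Φm θ := by
    rw [← hJ, div_le_iff₀ hS, mul_comm]; exact hseg1
  have hJhi : ∫ θ in a..a', Φm θ ≤ (sc.phi : ℝ) / ((tmS : ℕ) : ℝ) := by
    rw [← hJ, le_div_iff₀ hS, mul_comm]; exact hseg2
  have hmid : IntervalIntegrable Φm volume a a' := by
    have h1 : IntervalIntegrable (fun x => QHalfShear.progQ.toFunP params (Real.pi⁻¹ * x)) volume
        (((panelLeft hw d.j : ℚ) : ℝ) / Real.pi⁻¹) (((panelLeft hw (d.j + 1) : ℚ) : ℝ) / Real.pi⁻¹) :=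
      hsegI.comp_mul_left (h := enorm_ne_top) (h' := enorm_ne_top)
    have e1 : ((panelLeft hw d.j : ℚ) : ℝ) / Real.pi⁻¹ = a := by rw [div_inv_eq_mul, mul_comm]
    have e2 : ((panelLeft hw (d.j + 1) : ℚ) : ℝ) / Real.pi⁻¹ = a' := by rw [div_inv_eq_mul, mul_comm]
    rw [e1, e2] at h1
    have h2 := h1.div_const Real.pi
    have hfun : (fun x => QHalfShear.progQ.toFunP params (Real.pi⁻¹ * x) / Real.pi) = Φm := by
      funext x
      rw [hgA, mul_inv_cancel_left₀ hpi.ne' x, mul_div_cancel_right₀ _ hpi.ne']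
    rw [hfun] at h2
    exact h2
  -- the tube link
  have hT := P.kernel_integral_tube u₀_mem hKc (m := mθ) (r := ((ℓ.r : ℚ) : ℝ)) (η := (d.eta : ℝ) / ((tmS : ℕ) : ℝ)) (μ := μ)
    (E := ((sl.E : ℚ) : ℝ)) SF.hr SF.hημ (fun θ hθ => SF.tube_ends hθ) SF.res (fun θ hθ s hs => (SF.tube_D hθ hs).2.1) hEtube hmid
  rw [hwidth] at hT
  obtain ⟨hT1, hT2⟩ := hT
  have hEw : ((sl.E : ℚ) : ℝ) * (Real.pi / 32) ≤ ((sl.E : ℚ) : ℝ) * (((piHiQ : ℚ) : ℝ) / 32) :=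
    mul_le_mul_of_nonneg_left (by linarith) hE0
  refine ⟨?_, ?_, P.intervalIntegrable_kernel hKc u₀_mem⟩
  · have h1 : ((sl.Lo : ℚ) : ℝ) ≤ (sc.plo : ℝ) / ((tmS : ℕ) : ℝ) - ((sl.E : ℚ) : ℝ) * (((piHiQ : ℚ) : ℝ) / 32) := by
      have := (show ((sl.Lo : ℚ) : ℝ) ≤ ((((sc.plo : ℚ) / tmS - sl.E * (piHiQ / 32) : ℚ)) : ℝ) by exact_mod_cast cLo)
      push_cast at this; exact this
    change _ ≤ ∫ θ in a..a', shearK θ (rayRadius U Xa 0 u₀ θ)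
    linarith
  · have h1 : (sc.phi : ℝ) / ((tmS : ℕ) : ℝ) + ((sl.E : ℚ) : ℝ) * (((piHiQ : ℚ) : ℝ) / 32) ≤ ((sl.Hi : ℚ) : ℝ) := by
      have := (show ((((sc.phi : ℚ) / tmS + sl.E * (piHiQ / 32) : ℚ)) : ℝ) ≤ ((sl.Hi : ℚ) : ℝ) by exact_mod_cast cHi)
      push_cast at this; exact this
    change ∫ θ in a..a', shearK θ (rayRadius U Xa 0 u₀ θ) ≤ _
    linarith

end panel

end Summit.Ventures.FusionMHD.Models.CFIterLike.QHalf

end
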